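import Summits.QuantumAdvantage.QuantumAdvantage.Theorems.WalkTwoStepFarLocalBlocks

/-!
# (G♯) local engine — toward `FarLocal p`, part 3: the five-block input and the DISCORDANCE CRITERIA (split to the right)

Cell qa-qnc0, rung (G♯) = item stmt-QuantumAdvantage-23121 (planner qa-qnc0-p2 g24, ask P2-24b); prover qn-prover-3 g15.

For a far cut `g` with split `s = s_g > g` we write inputs as `blockInput uX k uY k' uZ = uX ++ corner k ++ (uY ++ corner k' ++ uZ)`
(corner `k` at the positions `g − 1, g`, corner `k'` at `s − 1, s`; `|uX| = g − 1`, `|uY| = s − g − 2`, `|uZ| = n − s − 1`).  In these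
coordinates `N(g) = |uX| + k`, `N(s) = |uX| + 1 + |uY| + k'`, `W = |uX| + |uY| + |uZ| + 2`, the flip `φ` at `g` negates `k` and the flip
`ψ` at `s` negates `k'` (`wt_blockInput`, `wtPrefix_blockInput_pos`, `wtPrefix_blockInput_split`, `cornerFlip_blockInput_pos`,
`cornerFlip_blockInput_split`).  The four-point formula (`WalkTwoStepFarLocalFlip`) then yields two sufficient conditions for
`disc u ≠ disc (ψ u)` stated purely in terms of the block weights (`discBit_ne_right_main`: cut `g` fires at `u`, its liveness flips,
no mirror term; `discBit_ne_right_mirror`: cut `g` fires neither at `u` nor at `ψ u` — its split count sits at `a₀ + 2` — while the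
mirror cut at position `s` co-observes `g`, flips its fire bit under `φ` and its liveness under `ψ`).  Arithmetic inputs: `α ≠ β` makes
consecutive split counts fire at most once (`not_fire_and_fire_succ`), `p ≥ 5` makes `a₀ + 1, a₀ + 2, a₀ + 3` non-firing
(`two_ne_zero'`, `three_ne_zero'`), and `A % 3 ≠ 1` makes exactly one of `A, A + 1` divisible by `3` (`decide_mod_three_ne`).
WHAT THIS IS NOT: no counting yet; the mirror-image case `s < g` is the next file; separation NOT moved.
-/

namespace Summit.QuantumAdvantage.AdviceFreeQNC0.LocalEngine

open Finset Classical

/-! ### Arithmetic helpers -/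

section Arith

variable {p : ℕ}

/-- With `α ≠ β`, two CONSECUTIVE split counts cannot both fire. -/
theorem not_fire_and_fire_succ [Fact p.Prime] {α β r W x : ZMod p} (hαβ : α ≠ β)
    (h1 : α * x + β * (W - x) = r) (h2 : α * (x + 1) + β * (W - (x + 1)) = r) : False := by
  have h : α - β = 0 := by linear_combination h2 - h1
  exact hαβ (sub_eq_zero.mp h)

/-- `2 ≠ 0` in `ZMod p` for a prime `p ≥ 5`. -/
theorem two_ne_zero' [Fact p.Prime] (hp5 : 5 ≤ p) : (2 : ZMod p) ≠ 0 := by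
  intro h
  have h' : ((2 : ℕ) : ZMod p) = 0 := by exact_mod_cast h
  rw [ZMod.natCast_eq_zero_iff] at h'
  have := Nat.le_of_dvd (by norm_num) h'
  omega

/-- `3 ≠ 0` in `ZMod p` for a prime `p ≥ 5`. -/
theorem three_ne_zero' [Fact p.Prime] (hp5 : 5 ≤ p) : (3 : ZMod p) ≠ 0 := by
  intro h
  have h' : ((3 : ℕ) : ZMod p) = 0 := by exact_mod_cast h
  rw [ZMod.natCast_eq_zero_iff] at h'
  have := Nat.le_of_dvd (by norm_num) h'
  omega

/-- If the split count sits at `a₀ + 2` (encoded without division: `(α−β)·x + β·W = r + 2(α−β)`), then neither `x` nor `x ± 1` fires. -/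
theorem not_fire_of_shift_two [Fact p.Prime] (hp5 : 5 ≤ p) {α β r W x : ZMod p} (hαβ : α ≠ β)
    (h : (α - β) * x + β * W = r + 2 * (α - β)) :
    α * x + β * (W - x) ≠ r ∧ α * (x + 1) + β * (W - (x + 1)) ≠ r ∧ ∀ y, y + 1 = x → α * y + β * (W - y) ≠ r := by
  have hd : α - β ≠ 0 := sub_ne_zero.mpr hαβ
  refine ⟨fun h1 => ?_, fun h2 => ?_, fun y hy h3 => ?_⟩
  · have : 2 * (α - β) = 0 := by linear_combination h1 - h
    exact (mul_ne_zero (two_ne_zero' hp5) hd) this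
  · have : 3 * (α - β) = 0 := by linear_combination h2 - h
    exact (mul_ne_zero (three_ne_zero' hp5) hd) this
  · subst hy
    have : 1 * (α - β) = 0 := by linear_combination h3 - h
    rw [one_mul] at this
    exact hd this

/-- If `A % 3 ≠ 1` and `B = A + 1`, exactly one of `A`, `B` is divisible by `3`: the two liveness decisions differ. -/
theorem decide_mod_three_ne (A B : ℕ) (hB : B = A + 1) (h : A % 3 ≠ 1) : decide (A % 3 ≠ 0) ≠ decide (B % 3 ≠ 0) := by
  subst hB
  have hA : A % 3 = 0 ∨ A % 3 = 2 := by omega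
  rcases hA with hA | hA
  · have h1 : (A + 1) % 3 = 1 := by omega
    simp [hA, h1]
  · have h1 : (A + 1) % 3 = 0 := by omega
    simp [hA, h1]

end Arith

/-! ### The five-block input (split to the right of the position) -/

section RightBlocks

variable {a b d : ℕ}

/-- `uX ++ corner k ++ (uY ++ corner k' ++ uZ)`. -/
def blockInput (uX : Fin a → Bool) (k : Bool) (uY : Fin b → Bool) (k' : Bool) (uZ : Fin d → Bool) :
    Fin (a + 2 + (b + 2 + d)) → Bool :=
  glue3 uX (corner k) (glue3 uY (corner k') uZ)

variable (uX : Fin a → Bool) (k : Bool) (uY : Fin b → Bool) (k' : Bool) (uZ : Fin d → Bool)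

/-- Total weight `W = |uX| + 1 + (|uY| + 1 + |uZ|)`. -/
theorem wt_blockInput : wt (blockInput uX k uY k' uZ) = wt uX + 1 + (wt uY + 1 + wt uZ) := by
  unfold blockInput
  rw [wt_glue3, wt_glue3, wt_corner, wt_corner]

/-- `N(g) = |uX| + k` (position `g = a + 1`). -/
theorem wtPrefix_blockInput_pos : wtPrefix (blockInput uX k uY k' uZ) (a + 1) = wt uX + k.toNat := by
  unfold blockInput
  rw [wtPrefix_glue3_mid _ _ _ (by omega) (by omega), show a + 1 - a = 1 by omega, wtPrefix_two_one, corner_apply_zero]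

/-- `N(s) = |uX| + 1 + (|uY| + k')` (split `s = a + 2 + (b + 1)`). -/
theorem wtPrefix_blockInput_split :
    wtPrefix (blockInput uX k uY k' uZ) (a + 2 + (b + 1)) = wt uX + 1 + (wt uY + k'.toNat) := by
  unfold blockInput
  rw [wtPrefix_glue3_of_ge _ _ _ (by omega), wt_corner, show a + 2 + (b + 1) - (a + 2) = b + 1 by omega,
    wtPrefix_glue3_mid _ _ _ (by omega) (by omega), show b + 1 - b = 1 by omega, wtPrefix_two_one, corner_apply_zero]

/-- The flip at the position negates `k`. -/
theorem cornerFlip_blockInput_pos :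
    cornerFlip (a + 2 + (b + 2 + d)) (a + 1) (blockInput uX k uY k' uZ) = blockInput uX (!k) uY k' uZ := by
  unfold blockInput
  rw [cornerFlip_glue3_mid _ _ _ le_rfl (by norm_num), cornerFlip_corner]

/-- The flip at the split negates `k'`. -/
theorem cornerFlip_blockInput_split :
    cornerFlip (a + 2 + (b + 2 + d)) (a + 2 + (b + 1)) (blockInput uX k uY k' uZ) = blockInput uX k uY (!k') uZ := by
  unfold blockInput
  rw [cornerFlip_glue3_right _ _ _ (by omega) (by omega), cornerFlip_glue3_mid _ _ _ le_rfl (by norm_num), cornerFlip_corner]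

end RightBlocks

/-! ### The two discordance criteria (split to the right) -/

section RightCriteria

variable {p : ℕ} [Fact p.Prime] {a b d : ℕ}

/-- the fire decision of a cut as a function of its split count `x` (with `W` the total weight, in `ZMod p`) -/
def fireAt (S : TwoStep p (a + 2 + (b + 2 + d))) (h : Fin (a + 2 + (b + 2 + d) + 1)) (W x : ZMod p) : Bool :=
  decide (S.α h * x + S.β h * (W - x) = S.r h)

/-- `S.y` is `fireAt` of the split count. -/
theorem y_eq_fireAt (S : TwoStep p (a + 2 + (b + 2 + d))) (h : Fin (a + 2 + (b + 2 + d) + 1))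
    (u : Fin (a + 2 + (b + 2 + d)) → Bool) :
    S.y h u = fireAt S h ((wt u : ℕ) : ZMod p) ((wtPrefix u (S.s h) : ℕ) : ZMod p) := by
  rw [y_eq_decide]; rfl

/-- **Criterion 1 (main term)**, split to the right.  Inputs `uX ++ corner k ++ (uY ++ corner k' ++ uZ)` on which the far cut `g`
(position `a + 1`, split `a + 2 + (b + 1)`, `α ≠ β`) FIRES, whose liveness flips under `φ`, and whose mirror term vanishes, have
`disc u ≠ disc (ψ u)`. -/
theorem discBit_ne_right_main (c : ℕ) (S : TwoStep p (a + 2 + (b + 2 + d)))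
    (g h₂ : Fin (a + 2 + (b + 2 + d) + 1)) (hg : g.val = a + 1) (hh₂ : h₂.val = a + 2 + (b + 1))
    (hsplit : S.s g = h₂.val) (hαβ : S.α g ≠ S.β g)
    (uX : Fin a → Bool) (k : Bool) (uY : Fin b → Bool) (k' : Bool) (uZ : Fin d → Bool)
    (hfire : fireAt S g (((wt uX + 1 + (wt uY + 1 + wt uZ) : ℕ) : ZMod p))
      (((wt uX + 1 + (wt uY + k'.toNat) : ℕ) : ZMod p)) = true)
    (hlive : (c + (a + 1) + (wt uX + 1 + (wt uY + 1 + wt uZ)) + wt uX) % 3 ≠ 1)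
    (hmirror : ¬ (S.s h₂ = a + 1 ∧
      fireAt S h₂ (((wt uX + 1 + (wt uY + 1 + wt uZ) : ℕ) : ZMod p)) ((wt uX : ℕ) : ZMod p)
        ≠ fireAt S h₂ (((wt uX + 1 + (wt uY + 1 + wt uZ) : ℕ) : ZMod p)) (((wt uX + 1 : ℕ)) : ZMod p))) :
    discBit c S g.val (blockInput uX k uY k' uZ)
      ≠ discBit c S g.val (cornerFlip (a + 2 + (b + 2 + d)) h₂.val (blockInput uX k uY k' uZ)) := by
  have hdist : g.val + 2 ≤ h₂.val ∨ h₂.val + 2 ≤ g.val := Or.inl (by omega)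
  apply discBit_ne_of_main c S g h₂ hsplit hdist
  · -- the fire bit of `g` flips under `ψ`: it fires at `u`, and consecutive split counts fire at most once
    rw [y_eq_fireAt, y_eq_fireAt, hsplit, hh₂, cornerFlip_blockInput_split, wtPrefix_blockInput_split, wtPrefix_blockInput_split,
      wt_blockInput, wt_blockInput, hfire]
    intro h
    have h1 := hfire
    have h2 := h.symm
    unfold fireAt at h1 h2
    rw [decide_eq_true_eq] at h1 h2
    cases k' with
    | false =>
      simp only [Bool.toNat_false, Bool.not_false, Bool.toNat_true, Nat.cast_add, Nat.cast_one, add_zero] at h1 h2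
      exact not_fire_and_fire_succ hαβ h1 (by rw [show ((wt uX : ℕ) : ZMod p) + 1 + ((wt uY : ℕ) : ZMod p) + 1
        = ((wt uX : ℕ) : ZMod p) + 1 + (((wt uY : ℕ) : ZMod p) + 1) by ring]; exact h2)
    | true =>
      simp only [Bool.toNat_true, Bool.not_true, Bool.toNat_false, Nat.cast_add, Nat.cast_one, add_zero] at h1 h2
      exact not_fire_and_fire_succ hαβ h2 (by rw [show ((wt uX : ℕ) : ZMod p) + 1 + ((wt uY : ℕ) : ZMod p) + 1
        = ((wt uX : ℕ) : ZMod p) + 1 + (((wt uY : ℕ) : ZMod p) + 1) by ring]; exact h1)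
  · -- the liveness of `g` flips under `φ`
    rw [hg, walkExp, walkExp, cornerFlip_blockInput_pos, wtPrefix_blockInput_pos, wtPrefix_blockInput_pos, wt_blockInput,
      wt_blockInput]
    cases k with
    | false =>
      simp only [Bool.toNat_false, Bool.not_false, Bool.toNat_true, add_zero]
      exact decide_mod_three_ne _ _ (by ring) (by omega)
    | true =>
      simp only [Bool.toNat_true, Bool.not_true, Bool.toNat_false, add_zero]
      exact (decide_mod_three_ne _ _ (by ring) (by omega)).symm
  · -- the mirror term vanishes
    rintro ⟨h1, h2, -⟩
    apply hmirror
    refine ⟨by rw [h1, hg], ?_⟩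
    rw [y_eq_fireAt, y_eq_fireAt, h1, hg, cornerFlip_blockInput_pos, wtPrefix_blockInput_pos, wtPrefix_blockInput_pos,
      wt_blockInput, wt_blockInput] at h2
    cases k with
    | false => simpa only [Bool.toNat_false, Bool.not_false, Bool.toNat_true, add_zero] using h2
    | true => simpa only [Bool.toNat_true, Bool.not_true, Bool.toNat_false, add_zero] using h2.symm

/-- **Criterion 2 (mirror term)**, split to the right.  Inputs on which the far cut `g` has its split count at `a₀ + 2` (so it fires
neither at `u` nor at `ψ u`), while the cut `h₂` at position `s` has split `g`, flips its fire bit under `φ` and its liveness under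
`ψ`, have `disc u ≠ disc (ψ u)`. -/
theorem discBit_ne_right_mirror (hp5 : 5 ≤ p) (c : ℕ) (S : TwoStep p (a + 2 + (b + 2 + d)))
    (g h₂ : Fin (a + 2 + (b + 2 + d) + 1)) (hg : g.val = a + 1) (hh₂ : h₂.val = a + 2 + (b + 1))
    (hsplit : S.s g = h₂.val) (hαβ : S.α g ≠ S.β g)
    (uX : Fin a → Bool) (k : Bool) (uY : Fin b → Bool) (k' : Bool) (uZ : Fin d → Bool)
    (hshift : (S.α g - S.β g) * (((wt uX + 1 + (wt uY + k'.toNat) : ℕ) : ZMod p))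
        + S.β g * (((wt uX + 1 + (wt uY + 1 + wt uZ) : ℕ) : ZMod p)) = S.r g + 2 * (S.α g - S.β g))
    (hm1 : S.s h₂ = a + 1)
    (hm2 : fireAt S h₂ (((wt uX + 1 + (wt uY + 1 + wt uZ) : ℕ) : ZMod p)) ((wt uX : ℕ) : ZMod p)
        ≠ fireAt S h₂ (((wt uX + 1 + (wt uY + 1 + wt uZ) : ℕ) : ZMod p)) (((wt uX + 1 : ℕ)) : ZMod p))
    (hm3 : (c + (a + 2 + (b + 1)) + (wt uX + 1 + (wt uY + 1 + wt uZ)) + (wt uX + 1 + wt uY)) % 3 ≠ 1) :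
    discBit c S g.val (blockInput uX k uY k' uZ)
      ≠ discBit c S g.val (cornerFlip (a + 2 + (b + 2 + d)) h₂.val (blockInput uX k uY k' uZ)) := by
  have hdist : g.val + 2 ≤ h₂.val ∨ h₂.val + 2 ≤ g.val := Or.inl (by omega)
  obtain ⟨hn0, hn1, hnm1⟩ := not_fire_of_shift_two hp5 hαβ hshift
  apply discBit_ne_of_mirror c S g h₂ hsplit hdist
  · -- `g` fires neither at `u` nor at `ψ u`
    rw [y_eq_fireAt, y_eq_fireAt, hsplit, hh₂, cornerFlip_blockInput_split, wtPrefix_blockInput_split, wtPrefix_blockInput_split,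
      wt_blockInput, wt_blockInput]
    unfold fireAt
    have e0 : decide (S.α g * (((wt uX + 1 + (wt uY + k'.toNat) : ℕ) : ZMod p))
        + S.β g * ((((wt uX + 1 + (wt uY + 1 + wt uZ) : ℕ) : ZMod p)) - (((wt uX + 1 + (wt uY + k'.toNat) : ℕ) : ZMod p)))
          = S.r g) = false := decide_eq_false hn0
    rw [e0]
    symm
    apply decide_eq_false
    cases k' with
    | false =>
      have e : (((wt uX + 1 + (wt uY + (!false).toNat) : ℕ) : ZMod p)) = (((wt uX + 1 + (wt uY + false.toNat) : ℕ) : ZMod p)) + 1 := by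
        simp only [Bool.not_false, Bool.toNat_true, Bool.toNat_false, add_zero]; push_cast; ring
      rw [e]; exact hn1
    | true =>
      apply hnm1
      simp only [Bool.not_true, Bool.toNat_false, Bool.toNat_true, add_zero]; push_cast; ring
  · exact by rw [hm1, hg]
  · rw [y_eq_fireAt, y_eq_fireAt, hm1, hg, cornerFlip_blockInput_pos, wtPrefix_blockInput_pos, wtPrefix_blockInput_pos,
      wt_blockInput, wt_blockInput]
    cases k with
    | false => simpa only [Bool.toNat_false, Bool.not_false, Bool.toNat_true, add_zero] using hm2
    | true => simpa only [Bool.toNat_true, Bool.not_true, Bool.toNat_false, add_zero] using hm2.symm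
  · rw [hh₂, walkExp, walkExp, cornerFlip_blockInput_split, wtPrefix_blockInput_split, wtPrefix_blockInput_split, wt_blockInput,
      wt_blockInput]
    cases k' with
    | false =>
      simp only [Bool.toNat_false, Bool.not_false, Bool.toNat_true, add_zero]
      exact decide_mod_three_ne _ _ (by ring) (by omega)
    | true =>
      simp only [Bool.toNat_true, Bool.not_true, Bool.toNat_false, add_zero]
      exact (decide_mod_three_ne _ _ (by ring) (by omega)).symm

end RightCriteria

end Summit.QuantumAdvantage.AdviceFreeQNC0.LocalEngine
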